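import Summits.QuantumFields.BalabanUV.Beta.PropagatorWoodburyFibre

/-!
# Beta / GAN24 / WoodburyFibreTransport — GAUGE TRANSPORT of gauge-fixed KKT inverses: the one-step kernels of two complete
# gauge slices are conjugate by the slice projector (field legs) and EQUAL on the multiplier block
# (gan24-p3 gen 4; BINDER-OWNERS row G-an2-4 ∕ (CONV-C), prover part P3 «Woodbury ∕ Schur-complement fibre reduction»; NOT IN PRINT —
# our proof attempt; census `HOME/b2b-balaban-gan24-p3/WOODBURY-FIBRE.md` rows (a), V3, V7)

HONEST FRAMING (page 1 of everything the β sub-cell writes): discharging `BetaPertH` makes Bałaban's UV stability UNCONDITIONAL — a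
real constructive-QFT result; it is NOT the continuum limit and NOT the Clay problem.  HONEST DEPENDENCY (cell reorg 2026-08-19, verbatim):
«continuum YM on T⁴ ⇐ BetaPertH ∧ nine spine estimates (0/9 proved); BetaPertH ⇐ (D1) ∧ (D4) ∧ CAP+tail; G-an2-4 gates asym, D1 and NE2/3/4.»
HONEST LABEL: (CONV-C) is NOT IN PRINT; this file discharges NOTHING of its K-slot (`GAN24.CombesThomas.ConvCK 3 Lc`, road P1); 0 wall binders
instantiated.  ABSOLUTE RULE honoured: nothing printed and nothing programme-internal is a hypothesis; every declaration is `[folklore]`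
finite-dimensional linear algebra over Mathlib `Matrix` and p3's `PropagatorWoodburyFibre.kkt` (the bordered matrix `[[H, Cᴴ], [C, 0]]`).

## What is proved (any field with a star; arbitrary finite index types `n` = fine fields, `m` = hard constraints, `g` = gauge data)

The setting of the cell's typed one-step system, abstractly: a Hermitian fine form `H` (e.g. `d*d`) DEGENERATE exactly along a «residual gauge»
subspace spanned by the columns of `D : Matrix n g 𝕜` (`H·D = 0`), hard constraint rows `Q` blind to it (`Q·D = 0` — for Bałaban's covariant
averaging `D` spans the gauge functions whose block averages are block-constant), and a GAUGE SLICE = rows `R : Matrix g n 𝕜`; the slice is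
COMPLETE when `R·D` is a unit (every gauge datum is realised by exactly one residual gauge).  The gauge-fixed one-step kernel is the inverse of
`kkt H (fromRows Q R) = [[H, Qᴴ, Rᴴ], [Q, 0, 0], [R, 0, 0]]`; its `(n,n)` block is the fluctuation covariance `Γ` (the `C^{(k)}`-type leg), the
`(n,m)` block the minimiser (`H_k`-type leg), the `(m,m)` block minus the effective coarse form (`Δ_k`-type block).
* §1 `lift R D = D·(R·D)⁻¹` (gauge datum ↦ the residual gauge realising it) and the SLICE PROJECTOR `proj R D = 1 − D·(R·D)⁻¹·R` (onto `ker R`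
  along `range D`): `R·proj = 0`, `proj·D = 0`, `A·proj = A` whenever `A·D = 0` (so `H·proj = H`, `Q·proj = Q`), and for two slices of the SAME
  residual gauge **`proj R₁ D · proj R₂ D = proj R₁ D`**.
* §2 (vectors) `gaugeMultiplier_eq_zero_of_invariant_source`: in any solution of the slice-`R` system whose source `J` is gauge-INVARIANT
  (`Dᴴ·J = 0`) the gauge multiplier vanishes (the mechanism of p3's `PropagatorWoodburyFibreGauge.gaugeMultiplier_eq_zero` ∕ an5's `wM_eq_zero`,
  here from `H·D = 0`, `Q·D = 0` alone); **`transport_stationarity` ∕ `transport_constraint` ∕ `transport_gauge`**: if `(A, μ)` is stationary for the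
  PROJECTED source `(proj R₁ D)ᴴ·J` with `Q·A = B`, then `A₁ := proj R₁ D·A + lift R₁ D·c`, the same `μ`, and `ν₁ := (lift R₁ D)ᴴ·J` solve the
  slice-`R₁` system with data `(J, B, c)` — WHATEVER slice (if any) produced `A`.
* §3 (matrices) `transport R₁ D X` = the explicit block matrix `[[P₁X₁₁P₁ᴴ, P₁X₁₂ᵐ, N₁], [X₂₁ᵐP₁ᴴ, X₂₂ᵐᵐ, 0], [N₁ᴴ, 0, 0]]`
  (`P₁ = proj R₁ D`, `N₁ = lift R₁ D`, `ᵐ` = the hard-constraint columns ∕ rows of the blocks of `X`);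
  **`kkt_mul_transport`**: `kkt H [Q;R₂] · X = 1 ⟹ kkt H [Q;R₁] · transport R₁ D X = 1`.  Hence (`inv_kkt_eq_transport`, `isUnit_kkt_of_slice`)
  well-posedness TRANSFERS between complete slices and **`(kkt H [Q;R₁])⁻¹ = transport R₁ D (kkt H [Q;R₂])⁻¹`**, read block by block:
  `flucBlock_transport` **`Γ₁ = P₁·Γ₂·P₁ᴴ`**, `minimiserBlock_transport` **`ℋ₁ = P₁·ℋ₂`**, `multiplierBlock_eq` **`𝒮₁ = 𝒮₂`** (the effective
  coarse form does not see the gauge slice), `gaugeColumn_eq_lift` (the response to a gauge datum is the pure gauge `N₁`), and the gauge-multiplier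
  blocks vanish (`gaugeMultiplierBlocks_eq_zero`).  §4 the case `R₂ = R₁` is the STRUCTURE THEOREM of one slice: `Γ = P·Γ·Pᴴ`, `ℋ = P·ℋ`.

## Why the row wants it (census rows (a) ∕ V3 ∕ V7 of WOODBURY-FIBRE.md made an identity; nothing of road P1 is touched)
(a) asked «for each fibre decomposition, does the entrywise field–field block factor?» and gen 2 LOCATED the answer numerically: through the
level-`N` rows the weak-Landau field blocks do NOT factor, with an exact rank-`(L^D − 1)` defect per generic Bloch fibre (job j078150), while the
multiplier block factors exactly (R10, now kernel by leaf-18's dictionary).  This file is the closed form of both facts for ANY two complete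
slices of one residual gauge (weak block-Landau at level `N′ = L·N` versus the slice composed from level `N`, or versus Bałaban's axial tower
(1.17)): the field–field blocks are CONJUGATE by the slice projector — they differ by pure-gauge legs `(P₁ − 1)·Γ₂·P₁ᴴ + Γ₂·(P₁ − 1)ᴴ`, whose
range per leg is `range D` (per superblock fibre: the `L^D` sub-block gauge constants minus the common one = `L^D − 1` directions, the count gen 2
measured) — and the multiplier blocks are EQUAL.  Consequently the residual `WoodburyFibre.FieldBlocksRate` of the weak-gauge family (= the K-slot,
`WoodburyFibreAssembly.convCKWall_iff_exists_fieldBlocksRate`) is, leg by leg, the rate of the SLICE-TRANSPORTED axial∕printed legs: V7's «rate of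
the weak-gauge section» is the rate of ONE operator family, the slice projectors `P_j = 1 − d·(R_j d)⁻¹·R_j` (Bałaban's Landau-type gauge
function [B5 (1.27)–(1.28) p.22] is this `(R_j d)⁻¹ R_j` — a LOCATOR of the printed object, not a hypothesis), composed with legs whose (CONV-C)
rates are printed-object statements (`C^{(k)}`: gan24-p2 `DirichletExhaustionCoer.convC_balaban`; `Δ_k`: `DirichletExhaustionDeltaZ`).  Road P1
(the swarm's L10–L12) proves the entrywise rate directly and remains THE road; this identity is the typed form of exit V3 should it be needed, and
the kernel statement of the located obstruction R11.  NOT instantiated on `Beta.OneStepResolventKernel.KInv` here (that junction is an2's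
`RelInvBorderedHessian` programme, `j = 0` landed there); NOT BetaPertH, NOT continuum, NOT Clay.
-/

namespace Summit.QuantumFields.BalabanUV.Beta.GAN24.WoodburyFibreTransport

open Matrix
open Summit.QuantumFields.BalabanUV.Beta.PropagatorWoodburyFibre (kkt)

variable {𝕜 : Type*} [Field 𝕜]
variable {n m g p : Type*} [Fintype n] [Fintype m] [Fintype g] [DecidableEq n] [DecidableEq m] [DecidableEq g]

/-! ## §1 Gauge lift and slice projector -/

section Projector

/-- The GAUGE LIFT of the slice `R`: the gauge datum `c` is realised by the residual gauge `D·(R·D)⁻¹·c`. [folklore] -/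
noncomputable def lift (R : Matrix g n 𝕜) (D : Matrix n g 𝕜) : Matrix n g 𝕜 := D * (R * D)⁻¹

/-- The SLICE PROJECTOR of the slice `R`: `1 − D·(R·D)⁻¹·R`, the projection onto `ker R` along `range D` (the linear «gauge transformation
into the slice»). [folklore] -/
noncomputable def proj (R : Matrix g n 𝕜) (D : Matrix n g 𝕜) : Matrix n n 𝕜 := 1 - lift R D * R

variable {R R₁ R₂ : Matrix g n 𝕜} {D : Matrix n g 𝕜}

/-- `proj + lift·R = 1` (definition). [folklore] -/
theorem proj_add_lift_mul (R : Matrix g n 𝕜) (D : Matrix n g 𝕜) : proj R D + lift R D * R = 1 :=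
  sub_add_cancel 1 _

omit [DecidableEq n] in
/-- A complete slice reads its own lift as the identity: `R·lift R D = 1`. [folklore] -/
theorem mul_lift (h : IsUnit (R * D)) : R * lift R D = 1 := by
  rw [lift, ← Matrix.mul_assoc, mul_nonsing_inv _ ((isUnit_iff_isUnit_det _).mp h)]

/-- The slice rows kill the slice projector: `R·proj R D = 0`. [folklore] -/
theorem mul_proj (h : IsUnit (R * D)) : R * proj R D = 0 := by
  rw [proj, Matrix.mul_sub, Matrix.mul_one, ← Matrix.mul_assoc, mul_lift h, Matrix.one_mul, sub_self]

omit [DecidableEq n] in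
/-- `lift·R` fixes the residual gauges: `lift R D·R·D = D`. [folklore] -/
theorem lift_mul_mul_D (h : IsUnit (R * D)) : lift R D * R * D = D := by
  rw [lift, Matrix.mul_assoc, Matrix.mul_assoc, nonsing_inv_mul _ ((isUnit_iff_isUnit_det _).mp h), Matrix.mul_one]

/-- The slice projector kills the residual gauges: `proj R D·D = 0`. [folklore] -/
theorem proj_mul_D (h : IsUnit (R * D)) : proj R D * D = 0 := by
  rw [proj, Matrix.sub_mul, Matrix.one_mul, lift_mul_mul_D h, sub_self]

omit [DecidableEq n] in
/-- Anything blind to the residual gauge is blind to the lift: `A·D = 0 ⟹ A·lift R D = 0`. [folklore] -/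
theorem mul_lift_of_mul_D (A : Matrix p n 𝕜) (hA : A * D = 0) (R : Matrix g n 𝕜) : A * lift R D = 0 := by
  rw [lift, ← Matrix.mul_assoc, hA, Matrix.zero_mul]

/-- Anything blind to the residual gauge does not see the slice projector: `A·D = 0 ⟹ A·proj R D = A` (so `H·proj = H`, `Q·proj = Q`).
[folklore] -/
theorem mul_proj_of_mul_D (A : Matrix p n 𝕜) (hA : A * D = 0) (R : Matrix g n 𝕜) : A * proj R D = A := by
  rw [proj, Matrix.mul_sub, Matrix.mul_one, ← Matrix.mul_assoc, mul_lift_of_mul_D A hA R, Matrix.zero_mul, sub_zero]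

/-- **Two slices of the same residual gauge**: `proj R₁ D·proj R₂ D = proj R₁ D` (gauge-transforming into slice `R₂` and then into slice `R₁`
is gauge-transforming into slice `R₁`). [folklore] -/
theorem proj_mul_proj (h₁ : IsUnit (R₁ * D)) (R₂ : Matrix g n 𝕜) : proj R₁ D * proj R₂ D = proj R₁ D :=
  mul_proj_of_mul_D _ (proj_mul_D h₁) R₂

/-- In particular the slice projector is idempotent. [folklore] -/
theorem proj_mul_proj_self (h : IsUnit (R * D)) : proj R D * proj R D = proj R D :=
  proj_mul_proj h R

/-- … and kills the lift of any other slice of the same residual gauge. [folklore] -/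
theorem proj_mul_lift (h₁ : IsUnit (R₁ * D)) (R₂ : Matrix g n 𝕜) : proj R₁ D * lift R₂ D = 0 :=
  mul_lift_of_mul_D _ (proj_mul_D h₁) R₂

/-! ### Transport of the hard constraint and of the gauge datum (vectors; no adjoint needed) -/

omit [Fintype m] [DecidableEq m] in
/-- **Transport of the hard constraint**: `Q·(proj R₁ D·A + lift R₁ D·c) = Q·A`. [folklore] -/
theorem transport_constraint {Q : Matrix m n 𝕜} (hQD : Q * D = 0) (R₁ : Matrix g n 𝕜) (A : n → 𝕜) (c : g → 𝕜) :
    Q *ᵥ (proj R₁ D *ᵥ A + lift R₁ D *ᵥ c) = Q *ᵥ A := by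
  rw [mulVec_add, mulVec_mulVec, mulVec_mulVec, mul_proj_of_mul_D Q hQD R₁, mul_lift_of_mul_D Q hQD R₁, zero_mulVec, add_zero]

/-- **Transport realises the gauge datum**: `R₁·(proj R₁ D·A + lift R₁ D·c) = c`. [folklore] -/
theorem transport_gauge (h₁ : IsUnit (R₁ * D)) (A : n → 𝕜) (c : g → 𝕜) :
    R₁ *ᵥ (proj R₁ D *ᵥ A + lift R₁ D *ᵥ c) = c := by
  rw [mulVec_add, mulVec_mulVec, mulVec_mulVec, mul_proj h₁, mul_lift h₁, zero_mulVec, zero_add, one_mulVec]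

end Projector

/-! ## §2 Transport of solutions (vectors) -/

section Vectors

variable [StarRing 𝕜] {H : Matrix n n 𝕜} {Q : Matrix m n 𝕜} {R R₁ : Matrix g n 𝕜} {D : Matrix n g 𝕜}

/-- Adjoint form: the residual gauges are invisible behind the adjoint projector, `Dᴴ·(proj R D)ᴴ = 0`. [folklore] -/
theorem conjTranspose_D_mul_conjTranspose_proj (h : IsUnit (R * D)) : Dᴴ * (proj R D)ᴴ = 0 := by
  rw [← conjTranspose_mul, proj_mul_D h, conjTranspose_zero]


omit [Fintype g] [DecidableEq n] [DecidableEq g] in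
/-- A Hermitian form degenerate along `D` is also left-degenerate: `Dᴴ·H = 0`. [folklore] -/
theorem conjTranspose_D_mul_form (hH : Hᴴ = H) (hHD : H * D = 0) : Dᴴ * H = 0 := by
  have h : Dᴴ * Hᴴ = 0 := by rw [← conjTranspose_mul, hHD, conjTranspose_zero]
  rwa [hH] at h

omit [Fintype m] [Fintype g] [DecidableEq n] [DecidableEq m] [DecidableEq g] in
/-- `Q·D = 0 ⟹ Dᴴ·Qᴴ = 0`. [folklore] -/
theorem conjTranspose_D_mul_conjTranspose_constraint (hQD : Q * D = 0) : Dᴴ * Qᴴ = 0 := by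
  rw [← conjTranspose_mul, hQD, conjTranspose_zero]

omit [DecidableEq n] [DecidableEq m] in
/-- **The gauge multiplier does no work on gauge-invariant sources.**  If `H·A + Qᴴ·μ + Rᴴ·ν = J` with `H` Hermitian, `H·D = 0`, `Q·D = 0`,
the slice `R` complete and the source gauge-invariant (`Dᴴ·J = 0`), then `ν = 0`. [folklore] -/
theorem gaugeMultiplier_eq_zero_of_invariant_source (hH : Hᴴ = H) (hHD : H * D = 0) (hQD : Q * D = 0) (hR : IsUnit (R * D))
    {A : n → 𝕜} {μ : m → 𝕜} {ν : g → 𝕜} {J : n → 𝕜} (hJ : Dᴴ *ᵥ J = 0)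
    (hs : H *ᵥ A + Qᴴ *ᵥ μ + Rᴴ *ᵥ ν = J) : ν = 0 := by
  have h1 : Dᴴ *ᵥ (H *ᵥ A + Qᴴ *ᵥ μ + Rᴴ *ᵥ ν) = (R * D)ᴴ *ᵥ ν := by
    rw [mulVec_add, mulVec_add, mulVec_mulVec, mulVec_mulVec, mulVec_mulVec, conjTranspose_D_mul_form hH hHD,
      conjTranspose_D_mul_conjTranspose_constraint hQD, ← conjTranspose_mul, zero_mulVec, zero_mulVec, zero_add, zero_add]
  rw [hs, hJ] at h1
  have h2 : ((R * D)⁻¹)ᴴ *ᵥ ((R * D)ᴴ *ᵥ ν) = ν := by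
    rw [mulVec_mulVec, ← conjTranspose_mul, mul_nonsing_inv _ ((isUnit_iff_isUnit_det _).mp hR), conjTranspose_one, one_mulVec]
  rw [← h2, ← h1, mulVec_zero]

omit [DecidableEq m] in
/-- **Transport of stationarity.**  If `(A, μ)` is stationary for the PROJECTED source, `H·A + Qᴴ·μ = (proj R₁ D)ᴴ·J`, then for every gauge
datum `c` the transported field `proj R₁ D·A + lift R₁ D·c`, the same `μ`, and the gauge multiplier `(lift R₁ D)ᴴ·J` are stationary for the
FULL source `J` in the slice-`R₁` system. [folklore] -/
theorem transport_stationarity (hHD : H * D = 0) {A : n → 𝕜} {μ : m → 𝕜} {J : n → 𝕜}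
    (hs : H *ᵥ A + Qᴴ *ᵥ μ = (proj R₁ D)ᴴ *ᵥ J) (c : g → 𝕜) :
    H *ᵥ (proj R₁ D *ᵥ A + lift R₁ D *ᵥ c) + Qᴴ *ᵥ μ + R₁ᴴ *ᵥ ((lift R₁ D)ᴴ *ᵥ J) = J := by
  rw [mulVec_add, mulVec_mulVec, mulVec_mulVec, mul_proj_of_mul_D H hHD R₁, mul_lift_of_mul_D H hHD R₁, zero_mulVec, add_zero, hs,
    mulVec_mulVec, ← conjTranspose_mul, ← add_mulVec, ← conjTranspose_add, proj_add_lift_mul, conjTranspose_one, one_mulVec]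

omit [DecidableEq n] [DecidableEq m] [DecidableEq g] in
/-- The bordered matrix `kkt H [Q;R]` acting on a block vector `(A, μ, ν)`:
`(H·A + Qᴴ·μ + Rᴴ·ν, Q·A, R·A)`. [folklore] -/
theorem kkt_mulVec_sumElim (H : Matrix n n 𝕜) (Q : Matrix m n 𝕜) (R : Matrix g n 𝕜) (A : n → 𝕜) (μ : m → 𝕜) (ν : g → 𝕜) :
    kkt H (fromRows Q R) *ᵥ Sum.elim A (Sum.elim μ ν) =
      Sum.elim (H *ᵥ A + Qᴴ *ᵥ μ + Rᴴ *ᵥ ν) (Sum.elim (Q *ᵥ A) (R *ᵥ A)) := by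
  rw [kkt, conjTranspose_fromRows_eq_fromCols_conjTranspose, fromBlocks_mulVec, Sum.elim_comp_inl, Sum.elim_comp_inr,
    fromCols_mulVec_sumElim, fromRows_mulVec, zero_mulVec, add_zero, add_assoc]

/-- Every block vector is `Sum.elim` of its three legs. [folklore] -/
theorem sumElim_legs {α β γ δ : Type*} (v : α ⊕ (β ⊕ γ) → δ) :
    Sum.elim (v ∘ Sum.inl) (Sum.elim ((v ∘ Sum.inr) ∘ Sum.inl) ((v ∘ Sum.inr) ∘ Sum.inr)) = v := by
  rw [Sum.elim_comp_inl_inr, Sum.elim_comp_inl_inr]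

end Vectors

/-! ## §3 Transport of the inverse (matrices) -/

section Matrices

omit [DecidableEq n] [DecidableEq m] [DecidableEq g] in
/-- Field leg of `X·(J′, B, c′)` through the blocks of `X`. [folklore] -/
theorem mulVec_leg_field (X : Matrix (n ⊕ (m ⊕ g)) (n ⊕ (m ⊕ g)) 𝕜) (J' : n → 𝕜) (B : m → 𝕜) (c' : g → 𝕜) :
    (X *ᵥ Sum.elim J' (Sum.elim B c')) ∘ Sum.inl = X.toBlocks₁₁ *ᵥ J' + (X.toBlocks₁₂.toCols₁ *ᵥ B + X.toBlocks₁₂.toCols₂ *ᵥ c') := by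
  conv_lhs => rw [← fromBlocks_toBlocks X, ← fromCols_toCols X.toBlocks₁₂]
  rw [fromBlocks_mulVec, Sum.elim_comp_inl, Sum.elim_comp_inl, Sum.elim_comp_inr, fromCols_mulVec_sumElim]

omit [DecidableEq n] [DecidableEq m] [DecidableEq g] in
/-- Hard-constraint multiplier leg of `X·(J′, B, c′)` through the blocks of `X`. [folklore] -/
theorem mulVec_leg_multiplier (X : Matrix (n ⊕ (m ⊕ g)) (n ⊕ (m ⊕ g)) 𝕜) (J' : n → 𝕜) (B : m → 𝕜) (c' : g → 𝕜) :
    ((X *ᵥ Sum.elim J' (Sum.elim B c')) ∘ Sum.inr) ∘ Sum.inl =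
      X.toBlocks₂₁.toRows₁ *ᵥ J' + (X.toBlocks₂₂.toBlocks₁₁ *ᵥ B + X.toBlocks₂₂.toBlocks₁₂ *ᵥ c') := by
  conv_lhs => rw [← fromBlocks_toBlocks X, ← fromRows_toRows X.toBlocks₂₁, ← fromBlocks_toBlocks X.toBlocks₂₂]
  rw [fromBlocks_mulVec, Sum.elim_comp_inr, Sum.elim_comp_inl, Sum.elim_comp_inr, fromRows_mulVec, fromBlocks_mulVec,
    Sum.elim_comp_inl, Sum.elim_comp_inr, ← Sum.elim_add_add, Sum.elim_comp_inl]

variable [StarRing 𝕜] {H : Matrix n n 𝕜} {Q : Matrix m n 𝕜} {R₁ R₂ : Matrix g n 𝕜} {D : Matrix n g 𝕜}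


/-- **The transported kernel.**  From a slice-`R₂` kernel `X = [[X₁₁, X₁₂], [X₂₁, X₂₂]]` (legs `n ∣ m ⊕ g`) build the slice-`R₁` kernel
`[[P₁·X₁₁·P₁ᴴ, (P₁·X₁₂ᵐ ∣ N₁)], [(X₂₁ᵐ·P₁ᴴ ; N₁ᴴ), [[X₂₂ᵐᵐ, 0], [0, 0]]]]`, `P₁ = proj R₁ D`, `N₁ = lift R₁ D`, `ᵐ` = hard-constraint part.
[folklore] -/
noncomputable def transport (R₁ : Matrix g n 𝕜) (D : Matrix n g 𝕜) (X : Matrix (n ⊕ (m ⊕ g)) (n ⊕ (m ⊕ g)) 𝕜) :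
    Matrix (n ⊕ (m ⊕ g)) (n ⊕ (m ⊕ g)) 𝕜 :=
  fromBlocks (proj R₁ D * X.toBlocks₁₁ * (proj R₁ D)ᴴ)
    (fromCols (proj R₁ D * X.toBlocks₁₂.toCols₁) (lift R₁ D))
    (fromRows (X.toBlocks₂₁.toRows₁ * (proj R₁ D)ᴴ) (lift R₁ D)ᴴ)
    (fromBlocks X.toBlocks₂₂.toBlocks₁₁ 0 0 0)

omit [DecidableEq m] in
/-- The transported kernel on a block vector `(J, B, c)`: with `(A, μ, ν) := X·((proj R₁ D)ᴴ·J, B, 0)` it returns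
`(proj R₁ D·A + lift R₁ D·c, μ, (lift R₁ D)ᴴ·J)`. [folklore] -/
theorem transport_mulVec (R₁ : Matrix g n 𝕜) (D : Matrix n g 𝕜) (X : Matrix (n ⊕ (m ⊕ g)) (n ⊕ (m ⊕ g)) 𝕜)
    (J : n → 𝕜) (B : m → 𝕜) (c : g → 𝕜) :
    transport R₁ D X *ᵥ Sum.elim J (Sum.elim B c) =
      Sum.elim (proj R₁ D *ᵥ ((X *ᵥ Sum.elim ((proj R₁ D)ᴴ *ᵥ J) (Sum.elim B 0)) ∘ Sum.inl) + lift R₁ D *ᵥ c)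
        (Sum.elim (((X *ᵥ Sum.elim ((proj R₁ D)ᴴ *ᵥ J) (Sum.elim B 0)) ∘ Sum.inr) ∘ Sum.inl) ((lift R₁ D)ᴴ *ᵥ J)) := by
  rw [mulVec_leg_field, mulVec_leg_multiplier, transport, fromBlocks_mulVec, Sum.elim_comp_inl, Sum.elim_comp_inr, Sum.elim_eq_iff]
  refine ⟨?_, ?_⟩
  · simp only [fromCols_mulVec_sumElim, mulVec_zero, add_zero, mulVec_add, mulVec_mulVec, Matrix.mul_assoc, add_assoc]
  · simp only [fromRows_mulVec, fromBlocks_mulVec, Sum.elim_comp_inl, Sum.elim_comp_inr, mulVec_zero, zero_mulVec, add_zero,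
      ← Sum.elim_add_add, mulVec_mulVec]

/-- **GAUGE TRANSPORT OF THE KKT INVERSE.**  `H` Hermitian and degenerate exactly along the residual gauge `D` seen by neither `H` nor `Q`
(`H·D = 0`, `Q·D = 0`), two COMPLETE slices `R₁`, `R₂` (`R_i·D` units).  If `X` is a right inverse of the slice-`R₂` bordered matrix, then
`transport R₁ D X` is a right inverse of the slice-`R₁` bordered matrix. [folklore] -/
theorem kkt_mul_transport (hH : Hᴴ = H) (hHD : H * D = 0) (hQD : Q * D = 0) (h₁ : IsUnit (R₁ * D)) (h₂ : IsUnit (R₂ * D))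
    {X : Matrix (n ⊕ (m ⊕ g)) (n ⊕ (m ⊕ g)) 𝕜} (hX : kkt H (fromRows Q R₂) * X = 1) :
    kkt H (fromRows Q R₁) * transport R₁ D X = 1 := by
  refine Matrix.ext_iff_mulVec.mpr fun v => ?_
  rw [← mulVec_mulVec, one_mulVec, ← sumElim_legs v, transport_mulVec]
  set J := v ∘ Sum.inl
  set B := (v ∘ Sum.inr) ∘ Sum.inl
  set c := (v ∘ Sum.inr) ∘ Sum.inr
  set w : n ⊕ (m ⊕ g) → 𝕜 := Sum.elim ((proj R₁ D)ᴴ *ᵥ J) (Sum.elim B 0) with hw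
  set A := (X *ᵥ w) ∘ Sum.inl
  set μ := ((X *ᵥ w) ∘ Sum.inr) ∘ Sum.inl
  set ν := ((X *ᵥ w) ∘ Sum.inr) ∘ Sum.inr
  have hsol : kkt H (fromRows Q R₂) *ᵥ Sum.elim A (Sum.elim μ ν) = w := by
    rw [sumElim_legs (X *ᵥ w), mulVec_mulVec, hX, one_mulVec]
  rw [kkt_mulVec_sumElim, hw, Sum.elim_eq_iff, Sum.elim_eq_iff] at hsol
  obtain ⟨hs, hQ, -⟩ := hsol
  have hν : ν = 0 :=
    gaugeMultiplier_eq_zero_of_invariant_source hH hHD hQD h₂ (by rw [mulVec_mulVec, conjTranspose_D_mul_conjTranspose_proj h₁,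
      zero_mulVec]) hs
  rw [hν, mulVec_zero, add_zero] at hs
  rw [kkt_mulVec_sumElim, transport_stationarity hHD hs, transport_constraint hQD, hQ, transport_gauge h₁]

/-- **Well-posedness transfers between complete slices**: if the slice-`R₂` bordered matrix is a unit, so is the slice-`R₁` one. [folklore] -/
theorem isUnit_kkt_of_slice (hH : Hᴴ = H) (hHD : H * D = 0) (hQD : Q * D = 0) (h₁ : IsUnit (R₁ * D)) (h₂ : IsUnit (R₂ * D))
    (hK : IsUnit (kkt H (fromRows Q R₂))) : IsUnit (kkt H (fromRows Q R₁)) :=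
  (isUnit_iff_isUnit_det _).mpr (isUnit_det_of_right_inverse
    (kkt_mul_transport hH hHD hQD h₁ h₂ (mul_nonsing_inv _ ((isUnit_iff_isUnit_det _).mp hK))))

/-- **`(kkt H [Q;R₁])⁻¹ = transport R₁ D (kkt H [Q;R₂])⁻¹`** — the one-step kernel of slice `R₁` IS the transported kernel of slice `R₂`.
[folklore] -/
theorem inv_kkt_eq_transport (hH : Hᴴ = H) (hHD : H * D = 0) (hQD : Q * D = 0) (h₁ : IsUnit (R₁ * D)) (h₂ : IsUnit (R₂ * D))
    (hK : IsUnit (kkt H (fromRows Q R₂))) :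
    (kkt H (fromRows Q R₁))⁻¹ = transport R₁ D (kkt H (fromRows Q R₂))⁻¹ :=
  inv_eq_right_inv (kkt_mul_transport hH hHD hQD h₁ h₂ (mul_nonsing_inv _ ((isUnit_iff_isUnit_det _).mp hK)))

/-- **FIELD–FIELD BLOCKS ARE CONJUGATE BY THE SLICE PROJECTOR**: `Γ₁ = proj R₁ D·Γ₂·(proj R₁ D)ᴴ` (the fluctuation covariances of two
complete gauge slices; the located field-block defect of the census, R11, in closed form). [folklore] -/
theorem flucBlock_transport (hH : Hᴴ = H) (hHD : H * D = 0) (hQD : Q * D = 0) (h₁ : IsUnit (R₁ * D)) (h₂ : IsUnit (R₂ * D))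
    (hK : IsUnit (kkt H (fromRows Q R₂))) :
    ((kkt H (fromRows Q R₁))⁻¹).toBlocks₁₁ = proj R₁ D * ((kkt H (fromRows Q R₂))⁻¹).toBlocks₁₁ * (proj R₁ D)ᴴ := by
  rw [inv_kkt_eq_transport hH hHD hQD h₁ h₂ hK, transport, toBlocks_fromBlocks₁₁]

/-- **MINIMISER COLUMNS ARE TRANSPORTED**: `ℋ₁ = proj R₁ D·ℋ₂` (the responses to hard-constraint data of two complete slices differ by a
pure gauge — the abstract form of leaf-18's `TorusGaugeDefect.curl_colA_eq_curl_colB`). [folklore] -/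
theorem minimiserBlock_transport (hH : Hᴴ = H) (hHD : H * D = 0) (hQD : Q * D = 0) (h₁ : IsUnit (R₁ * D)) (h₂ : IsUnit (R₂ * D))
    (hK : IsUnit (kkt H (fromRows Q R₂))) :
    ((kkt H (fromRows Q R₁))⁻¹).toBlocks₁₂.toCols₁ = proj R₁ D * ((kkt H (fromRows Q R₂))⁻¹).toBlocks₁₂.toCols₁ := by
  rw [inv_kkt_eq_transport hH hHD hQD h₁ h₂ hK, transport, toBlocks_fromBlocks₁₂, toCols₁_fromCols]

/-- **THE MULTIPLIER BLOCK DOES NOT SEE THE SLICE**: `𝒮₁ = 𝒮₂` (minus the effective coarse form `Δ_eff` — the abstract form of the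
gauge-independence half of the cell's (1.65) = (1.66) dictionary, leaf-18 `MultiplierDictionary` ∕ p3 `WoodburyFibreAssembly.multDict_holds`).
[folklore] -/
theorem multiplierBlock_eq (hH : Hᴴ = H) (hHD : H * D = 0) (hQD : Q * D = 0) (h₁ : IsUnit (R₁ * D)) (h₂ : IsUnit (R₂ * D))
    (hK : IsUnit (kkt H (fromRows Q R₂))) :
    ((kkt H (fromRows Q R₁))⁻¹).toBlocks₂₂.toBlocks₁₁ = ((kkt H (fromRows Q R₂))⁻¹).toBlocks₂₂.toBlocks₁₁ := by
  rw [inv_kkt_eq_transport hH hHD hQD h₁ h₂ hK, transport, toBlocks_fromBlocks₂₂, toBlocks_fromBlocks₁₁]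

/-- **The response to a gauge datum is the pure gauge realising it**: the gauge columns of the slice-`R₁` kernel are `lift R₁ D`. [folklore] -/
theorem gaugeColumn_eq_lift (hH : Hᴴ = H) (hHD : H * D = 0) (hQD : Q * D = 0) (h₁ : IsUnit (R₁ * D)) (h₂ : IsUnit (R₂ * D))
    (hK : IsUnit (kkt H (fromRows Q R₂))) :
    ((kkt H (fromRows Q R₁))⁻¹).toBlocks₁₂.toCols₂ = lift R₁ D := by
  rw [inv_kkt_eq_transport hH hHD hQD h₁ h₂ hK, transport, toBlocks_fromBlocks₁₂, toCols₂_fromCols]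

/-- **The gauge-multiplier blocks vanish**: in the slice-`R₁` kernel the `(m,g)`, `(g,m)` and `(g,g)` blocks are `0` (gauge multipliers do
no work on hard-constraint data or on gauge data). [folklore] -/
theorem gaugeMultiplierBlocks_eq_zero (hH : Hᴴ = H) (hHD : H * D = 0) (hQD : Q * D = 0) (h₁ : IsUnit (R₁ * D)) (h₂ : IsUnit (R₂ * D))
    (hK : IsUnit (kkt H (fromRows Q R₂))) :
    ((kkt H (fromRows Q R₁))⁻¹).toBlocks₂₂.toBlocks₁₂ = 0 ∧ ((kkt H (fromRows Q R₁))⁻¹).toBlocks₂₂.toBlocks₂₁ = 0 ∧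
      ((kkt H (fromRows Q R₁))⁻¹).toBlocks₂₂.toBlocks₂₂ = 0 := by
  rw [inv_kkt_eq_transport hH hHD hQD h₁ h₂ hK, transport, toBlocks_fromBlocks₂₂, toBlocks_fromBlocks₁₂, toBlocks_fromBlocks₂₁,
    toBlocks_fromBlocks₂₂]
  exact ⟨rfl, rfl, rfl⟩

end Matrices

/-! ## §4 One slice: the structure theorem (`R₂ = R₁`) -/

section OneSlice

variable [StarRing 𝕜] {H : Matrix n n 𝕜} {Q : Matrix m n 𝕜} {R : Matrix g n 𝕜} {D : Matrix n g 𝕜}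

/-- **STRUCTURE OF ONE GAUGE-FIXED KKT INVERSE**: `(kkt H [Q;R])⁻¹ = transport R D (kkt H [Q;R])⁻¹` — the field–field block lives on the
slice (`Γ = P·Γ·Pᴴ`), the minimiser columns live on the slice (`ℋ = P·ℋ`), the gauge columns are the lift, and all gauge-multiplier blocks
vanish. [folklore] -/
theorem inv_kkt_eq_transport_self (hH : Hᴴ = H) (hHD : H * D = 0) (hQD : Q * D = 0) (hR : IsUnit (R * D))
    (hK : IsUnit (kkt H (fromRows Q R))) : (kkt H (fromRows Q R))⁻¹ = transport R D (kkt H (fromRows Q R))⁻¹ :=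
  inv_kkt_eq_transport hH hHD hQD hR hR hK

/-- `Γ = proj R D·Γ·(proj R D)ᴴ`: the fluctuation covariance of a complete slice is supported on the slice in both legs. [folklore] -/
theorem flucBlock_eq_proj_conj (hH : Hᴴ = H) (hHD : H * D = 0) (hQD : Q * D = 0) (hR : IsUnit (R * D))
    (hK : IsUnit (kkt H (fromRows Q R))) :
    ((kkt H (fromRows Q R))⁻¹).toBlocks₁₁ = proj R D * ((kkt H (fromRows Q R))⁻¹).toBlocks₁₁ * (proj R D)ᴴ :=
  flucBlock_transport hH hHD hQD hR hR hK

/-- `R·Γ = 0`: the fluctuation covariance of a complete slice satisfies the slice condition in the output leg. [folklore] -/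
theorem gaugeRows_mul_flucBlock (hH : Hᴴ = H) (hHD : H * D = 0) (hQD : Q * D = 0) (hR : IsUnit (R * D))
    (hK : IsUnit (kkt H (fromRows Q R))) : R * ((kkt H (fromRows Q R))⁻¹).toBlocks₁₁ = 0 := by
  rw [flucBlock_eq_proj_conj hH hHD hQD hR hK, ← Matrix.mul_assoc, ← Matrix.mul_assoc, mul_proj hR, Matrix.zero_mul, Matrix.zero_mul]

end OneSlice

end Summit.QuantumFields.BalabanUV.Beta.GAN24.WoodburyFibreTransport
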